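import Summits.ResolutionOfSingularities.ResolutionOfSingularities.Theorems.EquisingularLiftEquisingularLiftNatFanGameNodes
import HarnessLib

/-!
# [OURS · L1 W4.5(b) · EL♮(3) · D-0157 DOOR 1, WIDTH row iso-w4] FAN-GAME WINNABILITY — brick 2b′: PHASE 1 (every node direction becomes a ray)

res-L1-w45b-iso-w4 g0 (prover, width seat; desk WIDTH TABLE D1/D1′; referee crit-2). `--supports stmt-ResolutionOfSingularities-20148 --as helper`.
Sorry-free, fact-free. OURS; counted 0; AI kernel work, weaker than expert review; NOT a statement of any manuscript; nothing of [Hironaka2017] is used;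
resolution of singularities in characteristic `p` is NOT proved here or anywhere in this chain.
Blueprint: `L/res-L1-w45b-iso-w4/FANGAME-MEMO.md` §6 («NODES FIRST, THEN WALLS»).

## What is proved (`n = 3`)

* `FanGame.NodesResolved V F` (every node direction of the table is, up to positive factors, a ray of a cone of `F`) and its persistence along
  E1-legal plays (`nodesResolved_star`, `nodesResolved_of_reach`: legal centres have two distinct rays, so every old ray survives in a child).
* ★★ `FanGame.phase1` — PHASE 1: from every position reachable from `orthantFan 3`, some E1-legal continuation reaches a position in which every node
  direction is a ray.  Loop `phase1_aux`: carry for each node direction a representation as an `ℕ`-combination of the rays of a cone (COVERAGE,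
  brick 2a); while some representation has ≥ 2 positive coefficients, star its support — LEGAL by `bad_of_nodePoint_rep` — and update all
  representations by `rep_star` (total coefficient mass drops by at least one); at the end each node direction is a positive multiple of a ray.
-/

set_option linter.dupNamespace false

open Matrix

namespace Summit.ResolutionOfSingularities.ResolutionOfSingularities.Cruxes.EquisingularLiftNat.Sections

namespace FanGame

/-! ### PHASE 1: every node direction becomes a ray -/

/-- `NodesResolved V F`: every node direction of the table is (a positive rational multiple of) a ray of some cone of the position `F`.
[OURS · bookkeeping] -/
def NodesResolved (V : Finset (Fin 3 → ℕ)) (F : Finset (Finset (Ray 3))) : Prop :=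
  ∀ w ∈ nodeDirs V, ∃ σ ∈ F, ∃ ρ ∈ σ, ∃ a b : ℤ, 0 < a ∧ 0 < b ∧ a • w = b • ρ

/-- Rays persist under a star at a face with two distinct rays; hence `NodesResolved` persists. -/
theorem nodesResolved_star {V : Finset (Fin 3 → ℕ)} {F : Finset (Finset (Ray 3))} (h : NodesResolved V F) {τ : Finset (Ray 3)}
    (hτ : ∃ t ∈ τ, ∃ t' ∈ τ, t ≠ t') : NodesResolved V (star F τ) := by
  classical
  intro w hw
  obtain ⟨σ, hσ, ρ, hρ, a, b, ha, hb, hab⟩ := h w hw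
  by_cases hτσ : τ ⊆ σ
  · -- pick `t ∈ τ` different from `ρ`; `ρ` survives in the child `insert (Σ τ) (σ.erase t)`
    obtain ⟨t, ht, t', ht', htt'⟩ := hτ
    obtain ⟨s, hs, hsρ⟩ : ∃ s ∈ τ, s ≠ ρ := by
      by_cases h1 : t = ρ
      · exact ⟨t', ht', fun h2 => htt' (h1.trans h2.symm)⟩
      · exact ⟨t, ht, h1⟩
    refine ⟨insert (∑ ρ ∈ τ, ρ) (σ.erase s), (ND.mem_star_iff F τ _).2 (Or.inr ⟨σ, hσ, hτσ, s, hs, rfl⟩), ρ,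
      Finset.mem_insert_of_mem (Finset.mem_erase.2 ⟨hsρ.symm, hρ⟩), a, b, ha, hb, hab⟩
  · exact ⟨σ, (ND.mem_star_iff F τ σ).2 (Or.inl ⟨hσ, hτσ⟩), ρ, hρ, a, b, ha, hb, hab⟩

/-- `NodesResolved` persists along every E1-legal play (legal centres have two distinct rays). -/
theorem nodesResolved_of_reach {V : Finset (Fin 3 → ℕ)} (hV : V.Nonempty) {F F' : Finset (Finset (Ray 3))} (h : Reach V F F')
    (h₀ : NodesResolved V F) : NodesResolved V F' := by
  induction h with
  | refl => exact h₀
  | step F₂ τ σ _ _ _ _ hB ih =>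
    obtain ⟨t, ht, t', ht', htt'⟩ := ND.exists_ne_of_bad hV hB
    exact nodesResolved_star ih ⟨t, ht, t', ht', htt'⟩

/-- Dropping the rays with zero coefficient from a representation. -/
theorem rep_filter_pos {σ : Finset (Ray 3)} {c : Ray 3 → ℕ} {x : Ray 3} (hx : Rep σ c x) :
    Rep (σ.filter (fun ρ => 0 < c ρ)) c x := by
  classical
  unfold Rep at hx ⊢
  rw [Finset.sum_filter, ← hx]
  refine Finset.sum_congr rfl (fun ρ _ => ?_)
  split_ifs with h
  · rfl
  · rw [Nat.eq_zero_of_not_pos h]; simp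

/-- **PHASE 1 (inner loop).**  [OURS · L1 W4.5b · brick 2b] -/
theorem phase1_aux (V : Finset (Fin 3 → ℕ)) :
    ∀ (M : ℕ) (F : Finset (Finset (Ray 3))) (sig : Ray 3 → Finset (Ray 3)) (coef : Ray 3 → Ray 3 → ℕ),
      Reach V (orthantFan 3) F → (∀ w ∈ nodeDirs V, sig w ∈ F ∧ Rep (sig w) (coef w) w) →
      (∑ w ∈ nodeDirs V, ∑ ρ ∈ sig w, coef w ρ) ≤ M →
      ∃ F', Reach V F F' ∧ NodesResolved V F' := by
  classical
  intro M
  induction M with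
  | zero =>
    -- zero total mass is impossible unless there is no node direction at all (each `w ≠ 0` needs a positive coefficient)
    intro F sig coef hR hW hM
    refine ⟨F, Reach.refl F, fun w hw => ?_⟩
    exfalso
    obtain ⟨hw0, hwne, -⟩ := mem_nodeDirs hw
    obtain ⟨hσ, hrep⟩ := hW w hw
    have hzero : ∑ ρ ∈ sig w, coef w ρ = 0 := by
      have := Finset.single_le_sum (f := fun w => ∑ ρ ∈ sig w, coef w ρ) (fun _ _ => Nat.zero_le _) hw
      omega
    apply hwne
    rw [← hrep]
    refine Finset.sum_eq_zero (fun ρ hρ => ?_)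
    rw [Finset.sum_eq_zero_iff.1 hzero ρ hρ]; simp
  | succ M ih =>
    intro F sig coef hR hW hM
    by_cases hbig : ∃ w ∈ nodeDirs V, 2 ≤ ((sig w).filter (fun ρ => 0 < coef w ρ)).card
    · -- STAR the support `S` of the representation of such a `w₀`
      obtain ⟨w₀, hw₀, hcard⟩ := hbig
      obtain ⟨hw₀0, hw₀ne, hnode⟩ := mem_nodeDirs hw₀
      obtain ⟨hσ₀, hrep₀⟩ := hW w₀ hw₀
      set S := (sig w₀).filter (fun ρ => 0 < coef w₀ ρ) with hSdef
      have hSσ : S ⊆ sig w₀ := Finset.filter_subset _ _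
      have hSne : S.Nonempty := Finset.card_pos.1 (by omega)
      have hsmooth : ND.IsSmoothCone (sig w₀) := ND.isSmoothCone_of_reach_orthant V hR hσ₀
      have hcard3 : (sig w₀).card ≤ 3 := card_le_three_of_reach_orthant le_rfl V hR _ hσ₀
      have hcodim : ∀ ρ ∈ sig w₀, ∀ ρ' ∈ sig w₀, ρ ∉ S → ρ' ∉ S → ρ = ρ' := by
        intro ρ hρ ρ' hρ' hρS hρ'S
        have hsub : S ∪ {ρ, ρ'} ⊆ sig w₀ := by
          intro x hx
          rcases Finset.mem_union.1 hx with hx | hx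
          · exact hSσ hx
          · rcases Finset.mem_insert.1 hx with rfl | hx; · exact hρ
            rw [Finset.mem_singleton] at hx; rw [hx]; exact hρ'
        have h1 := Finset.card_le_card hsub
        rw [Finset.card_union_of_disjoint (Finset.disjoint_left.2 (fun x hxS hx => by
          rcases Finset.mem_insert.1 hx with rfl | hx; · exact hρS hxS
          · rw [Finset.mem_singleton] at hx; exact hρ'S (hx ▸ hxS)))] at h1
        by_contra hne
        rw [Finset.card_pair hne] at h1
        omega
      have hBad : Bad V S :=
        bad_of_nodePoint_rep hsmooth hcodim (fun ρ hρ => (Finset.mem_filter.1 hρ).2) (rep_filter_pos hrep₀) hnode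
      have hR₁ : Reach V F (star F S) := Reach.step F F S (sig w₀) (Reach.refl F) hσ₀ hSσ hSne hBad
      have hR₁' : Reach V (orthantFan 3) (star F S) := reach_trans V hR₁ hR
      -- new witnesses
      have key : ∀ w ∈ nodeDirs V, ∃ σ' ∈ star F S, ∃ c' : Ray 3 → ℕ, Rep σ' c' w ∧
          (∑ ρ ∈ σ', c' ρ) + (if S ⊆ sig w then (S.card - 1) * (S.inf' hSne (coef w)) else 0) = ∑ ρ ∈ sig w, coef w ρ := by
        intro w hw
        obtain ⟨hσ, hrep⟩ := hW w hw
        by_cases hSw : S ⊆ sig w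
        · obtain ⟨t₀, ht₀, hmin⟩ := Finset.exists_mem_eq_inf' hSne (coef w)
          have hmin' : ∀ ρ ∈ S, coef w t₀ ≤ coef w ρ := fun ρ hρ => by rw [← hmin]; exact Finset.inf'_le _ hρ
          obtain ⟨c', hrep', hsum'⟩ := rep_star hrep hSw ht₀ hmin'
          refine ⟨_, (ND.mem_star_iff F S _).2 (Or.inr ⟨sig w, hσ, hSw, t₀, ht₀, rfl⟩), c', hrep', ?_⟩
          rw [if_pos hSw, hmin]; exact hsum'
        · exact ⟨sig w, (ND.mem_star_iff F S _).2 (Or.inl ⟨hσ, hSw⟩), coef w, hrep, by rw [if_neg hSw, Nat.add_zero]⟩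
      choose sig' hsig' coef' hrep' hsum' using key
      -- the functions `sig'`, `coef'` are only specified on `nodeDirs V`; extend by the old ones elsewhere
      let sig'' : Ray 3 → Finset (Ray 3) := fun w => if hw : w ∈ nodeDirs V then sig' w hw else sig w
      let coef'' : Ray 3 → Ray 3 → ℕ := fun w => if hw : w ∈ nodeDirs V then coef' w hw else coef w
      have hW' : ∀ w ∈ nodeDirs V, sig'' w ∈ star F S ∧ Rep (sig'' w) (coef'' w) w := by
        intro w hw
        simp only [sig'', coef'', dif_pos hw]
        exact ⟨hsig' w hw, hrep' w hw⟩
      -- the measure drops by at least one (at `w₀`)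
      have hdrop : (∑ w ∈ nodeDirs V, ∑ ρ ∈ sig'' w, coef'' w ρ) + 1 ≤ ∑ w ∈ nodeDirs V, ∑ ρ ∈ sig w, coef w ρ := by
        have hle : ∀ w ∈ nodeDirs V, ∑ ρ ∈ sig'' w, coef'' w ρ +
            (if S ⊆ sig w then (S.card - 1) * (S.inf' hSne (coef w)) else 0) = ∑ ρ ∈ sig w, coef w ρ := by
          intro w hw
          simp only [sig'', coef'', dif_pos hw]
          exact hsum' w hw
        have hextra : 1 ≤ (if S ⊆ sig w₀ then (S.card - 1) * (S.inf' hSne (coef w₀)) else 0) := by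
          rw [if_pos hSσ]
          obtain ⟨t₀, ht₀, hmin⟩ := Finset.exists_mem_eq_inf' hSne (coef w₀)
          rw [hmin]
          have h1 : 1 ≤ S.card - 1 := by omega
          have h2 : 1 ≤ coef w₀ t₀ := (Finset.mem_filter.1 ht₀).2
          exact one_le_mul h1 h2
        calc (∑ w ∈ nodeDirs V, ∑ ρ ∈ sig'' w, coef'' w ρ) + 1
            ≤ (∑ w ∈ nodeDirs V, ∑ ρ ∈ sig'' w, coef'' w ρ) +
                ∑ w ∈ nodeDirs V, (if S ⊆ sig w then (S.card - 1) * (S.inf' hSne (coef w)) else 0) :=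
              Nat.add_le_add_left (hextra.trans (Finset.single_le_sum
                (f := fun w => if S ⊆ sig w then (S.card - 1) * (S.inf' hSne (coef w)) else 0)
                (fun _ _ => Nat.zero_le _) hw₀)) _
          _ = ∑ w ∈ nodeDirs V, ∑ ρ ∈ sig w, coef w ρ := by
              rw [← Finset.sum_add_distrib]; exact Finset.sum_congr rfl hle
      obtain ⟨F', hRF', hres⟩ := ih (star F S) sig'' coef'' hR₁' hW' (by omega)
      exact ⟨F', reach_trans V hRF' hR₁, hres⟩
    · -- every node direction has a representation with at most one positive coefficient: it is a multiple of a ray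
      refine ⟨F, Reach.refl F, fun w hw => ?_⟩
      obtain ⟨hw0, hwne, -⟩ := mem_nodeDirs hw
      obtain ⟨hσ, hrep⟩ := hW w hw
      have hc1 : ((sig w).filter (fun ρ => 0 < coef w ρ)).card ≤ 1 := by
        by_contra h; exact hbig ⟨w, hw, by omega⟩
      have hrep' := rep_filter_pos hrep
      rcases Finset.card_le_one_iff_subset_singleton.1 hc1 with ⟨ρ₁, hρ₁⟩
      rcases Finset.subset_singleton_iff.1 hρ₁ with h0 | h1
      · exfalso; apply hwne
        have e := hrep'
        unfold Rep at e
        rw [h0, Finset.sum_empty] at e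
        exact e.symm
      · have hρ₁mem : ρ₁ ∈ (sig w).filter (fun ρ => 0 < coef w ρ) := by rw [h1]; exact Finset.mem_singleton_self _
        obtain ⟨hρ₁σ, hpos⟩ := Finset.mem_filter.1 hρ₁mem
        refine ⟨sig w, hσ, ρ₁, hρ₁σ, 1, coef w ρ₁, one_pos, by exact_mod_cast hpos, ?_⟩
        have e := hrep'
        unfold Rep at e
        rw [h1, Finset.sum_singleton] at e
        rw [one_smul, e]

/-- **PHASE 1.**  From every position of the local game in dimension three some E1-legal continuation makes every node direction of the table a ray.
[OURS · L1 W4.5b · row iso-w4, brick 2b] -/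
theorem phase1 (V : Finset (Fin 3 → ℕ)) {F : Finset (Finset (Ray 3))} (hR : Reach V (orthantFan 3) F) :
    ∃ F', Reach V F F' ∧ NodesResolved V F' := by
  classical
  have hcov := covers_of_reach_orthant V hR
  have key : ∀ w ∈ nodeDirs V, ∃ σ ∈ F, ∃ c : Ray 3 → ℕ, Rep σ c w := fun w hw => hcov w (mem_nodeDirs hw).1
  choose sig hsig coef hrep using key
  let sig' : Ray 3 → Finset (Ray 3) := fun w => if hw : w ∈ nodeDirs V then sig w hw else ∅
  let coef' : Ray 3 → Ray 3 → ℕ := fun w => if hw : w ∈ nodeDirs V then coef w hw else fun _ => 0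
  exact phase1_aux V _ F sig' coef' hR (fun w hw => by simp only [sig', coef', dif_pos hw]; exact ⟨hsig w hw, hrep w hw⟩) le_rfl


end FanGame

end Summit.ResolutionOfSingularities.ResolutionOfSingularities.Cruxes.EquisingularLiftNat.Sections
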